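import Summits.QuantumFields.BalabanUV.T4Continuum.Support.NE7MinimalActionLipschitz
import Summits.QuantumFields.BalabanUV.T4Continuum.Support.NE7CriticalOrbitQuadraticGrowthAnyDatum
import HarnessLib

/-!
# NE7MinimiserHoelderHalf — HÖLDER-½ DEPENDENCE OF THE MINIMAL ORBIT `U_k(V)` ON THE DATUM `V` (modulo gauge, at every small datum, in the chart ⊕ weighted-energy currency):
# for every `U(n)`, every `L ≥ 2`, `d = 4`, over the small data, at every level `j+1` and base datum `V₀` with (8)∃ minimiser `U♯`: `∃ C ≥ 0`, EVENTUALLY as the unitary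
# `N`-periodic datum `V → V₀`, every minimiser `U` over `V` has a periodic unitary gauge copy `U^{u} = chart_{U♯}(Φ)` and there is `Φ′` with `chart_{U♯}(Φ′)` admissible over
# `V₀`, `‖Φ − Φ′‖ ≤ C‖y(V)‖`, and `chart_{U♯}(Φ′)^{u′} = U♯·e^{X′}` with `‖X′‖_w² ≤ C‖y(V)‖` — i.e. `U` is within `O(‖y(V)‖) ⊕ O(‖y(V)‖^{1∕2})` of the orbit of `U♯`
# (gen 113's two-sided Lipschitz construction `NE7MinimalActionLipschitz` + the k-uniform quadratic growth ✓ p819664 `NE7CriticalOrbitQuadraticGrowthAnyDatum` at the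
# critical centre `U♯`) — the quantitative form of the continuity ✓ p819399, first rung of print's «U_k(V) analytic in V» ([Balaban1985Variational] p. 279)

Cell `pub-balaban`, rung (B)+1 sub-cell t4, lineage `b2b-balaban-t4-ne7-p1` (CRUX PROVER NE7 #1 = OWNER of BINDER row NE7), generation 113.  Memo
`t4/b2b-balaban-t4-ne7-p1-g113/ROAD-G113.md` §5ter.
WHAT ([folklore]; 0 def, 0 sorry; `d = 4`, every `U(n)`, every `L ≥ 2`).  **`minimiser_hoelder_half`** (statement in the theorem's docstring).
HONEST FRAMING (page 1): soft calculus and topology over landed kernel theorems; `C` existential, NOT uniform in `V₀`, `j`, `N`; the closeness is in the MIXED currency (chart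
sup-distance for the first leg, weighted energy `energyNormW` for the second) and only Hölder-½ (Lipschitz∕C¹∕analytic = the implicit-function continuation on the Euler–Lagrange
system, NOT claimed); nothing of Bałaban's asserted as an axiom and NOT his method; finite 4-torus, small data; NOT NE7 as a spine node (dagwriter∕referees' call), NOT NE3; spine
0∕9; NOT infinite volume, NOT mass gap, NOT BetaPertH, NOT Clay (continuum YM on T⁴ ⇐ BetaPertH ∧ nine spine estimates).
-/

set_option autoImplicit false

open scoped BigOperators Matrix Matrix.Norms.L2Operator Topology
open NormedSpace Finset Set Filter

namespace Summit.QuantumFields.BalabanUV.T4Continuum.NE7MinimiserHoelderHalf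

open Literature.MathematicalPhysics.QuantumFieldTheory.Balaban1983to89
open B7Prop1Explicit B7Prop2Explicit
open T4AveragingDeficitWall (IsUnitaryCfg IsSkewDir SmallField fineAction vary)
open T4AveragingDeficitWallBoundary (IsPeriodicCfg periodBox)
open AveragingDeficitPeriodicCounting (IsPeriodicDir)
open AveragingDeficitTorusChart (TDir chart)
open AveragingDeficitChartCalculus (relLog relLog_self)
open AveragingDeficitTwoLevelPrep (skewSub skewPR)
open AveragingDeficitMultiLevelPrep (tower levelQ LevelSmall cavgIter TangentIter)
open AveragingDeficitMultiLevelBridge (cavgIter_eq_avgIter)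
open MinimalActionLevels (perWin levelAction stepWt stepWt_pos)
open MinimalActionSandwich (IsMinimiser admissible minAct)
open MinimalActionRate (sfClass)
open NE3HessForm (dAction)
open NE3EnergyShapes (IsUnitarySite IsPeriodicSite)
open NE3EnergyWeightedShapes (energyNormW)
open NE7AdmissibleFibreLHC (period_succ_eq continuous_relVal tendsto_skewPR_relLog eventually_near_base)
open NE7AdmissibleFibreQuantitativeBase (chart_fibre_quantitative)
open NE7TorusChartDecoding (chart_skewPR_relLog_eq norm_skewPR_relLog_le)
open NE7DatumCoordinateStabiliser (norm_skewPR_relLog_gaugeAct_stab)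
open NE7MinimalOrbitDatumContinuity (thresholds minimisers_upperHemicontinuous)
open NE7MinimalOrbitDatumContinuityGauge (continuous_gaugeAct)
open NE7MinimalOrbitUniqueGeneric (minimal_orbit_unique_generic)
open NE7MinimalActionUpperLipschitz (minAct_upper_lipschitz)
open NE7OpenOfMinimisation (tanCritical_of_isMinimiser)
open NE7CriticalOrbitQuadraticGrowthAnyDatum (action_quadratic_growth_any_datum)
open NE7EtaMinimiserGaugeCovariance (levelAction_gaugeAct isMinimiser_gaugeAct avgIter_gaugeAct_sfClass isUnitarySite_corner)
open AveragingDeficitKDatum (gaugeAct_inv_gaugeAct)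

noncomputable section

variable {n : Type} [Fintype n] [DecidableEq n]

set_option maxHeartbeats 800000 in
/-- **HÖLDER-½ DEPENDENCE OF THE MINIMAL ORBIT ON THE DATUM, EVERY `U(n)`, EVERY `L ≥ 2`, `d = 4`.**  Over the small data, at every level `j+1` and base datum `V₀`: there is a
minimiser `U♯` over `V₀` and `C ≥ 0` such that EVENTUALLY as the unitary `N`-periodic datum `V → V₀`, every minimiser `U` over `V` admits: a unitary `(N·L^{j+1})`-periodic gauge
`u` and chart parameters `Φ, Φ′ ∈ skewSub (L·tower L N j)` with `U^{u} = chart_{U♯}(Φ)`, `chart_{U♯}(Φ′) ∈ admissible (sfClass 4 L N ε) L (j+1) V₀`, `‖Φ − Φ′‖ ≤ C‖y(V)‖`, and a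
unitary periodic `u′` and skew periodic `X′` with `chart_{U♯}(Φ′)^{u′} = U♯·e^{X′}`, `energyNormW L (j+1) U♯ X′ (periodBox (N·L^{j+1}))² ≤ C‖y(V)‖`, where `y(V) = skewPR N
(relLog N V₀ V)`. [folklore] -/
theorem minimiser_hoelder_half [Nonempty n] {L : ℕ} [NeZero L] (hL : 2 ≤ L) :
    ∃ ε₀ : ℝ, 0 < ε₀ ∧ ∀ ε : ℝ, 0 < ε → ε ≤ ε₀ → ∀ (N : ℕ) [NeZero N], 1 ≤ N →
      ∃ δV : ℝ, 0 < δV ∧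
        ∀ V₀ ∈ {V : Site 4 → Fin 4 → (Matrix n n ℂ)ˣ | IsUnitaryCfg V ∧ IsPeriodicCfg V (N : ℤ) ∧ SmallField V δV},
        ∀ j : ℕ, ∃ Us : Site 4 → Fin 4 → (Matrix n n ℂ)ˣ, IsMinimiser 4 (sfClass 4 L N ε) L N (j + 1) V₀ Us ∧ ∃ C : ℝ, 0 ≤ C ∧
          ∀ᶠ V in 𝓝 V₀, IsUnitaryCfg V → IsPeriodicCfg V (N : ℤ) →
            ∀ U : Site 4 → Fin 4 → (Matrix n n ℂ)ˣ, IsMinimiser 4 (sfClass 4 L N ε) L N (j + 1) V U →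
              ∃ (u : Site 4 → (Matrix n n ℂ)ˣ) (Φ Φ' : ↥(skewSub 4 n (L * tower L N j))) (u' : Site 4 → (Matrix n n ℂ)ˣ) (X' : Site 4 → Fin 4 → Matrix n n ℂ),
                IsUnitarySite u ∧ IsPeriodicSite u ((N * L ^ (j + 1) : ℕ) : ℤ) ∧
                gaugeAct u U = chart (ContinuousLinearMap.id ℝ (Matrix n n ℂ)) (L * tower L N j) Us (Φ : TDir 4 n (L * tower L N j)) ∧
                chart (ContinuousLinearMap.id ℝ (Matrix n n ℂ)) (L * tower L N j) Us (Φ' : TDir 4 n (L * tower L N j)) ∈ admissible (sfClass 4 L N ε) L (j + 1) V₀ ∧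
                ‖Φ - Φ'‖ ≤ C * ‖skewPR N (relLog N V₀ V)‖ ∧
                IsUnitarySite u' ∧ IsPeriodicSite u' ((N * L ^ (j + 1) : ℕ) : ℤ) ∧ IsSkewDir X' ∧ IsPeriodicDir X' ((N * L ^ (j + 1) : ℕ) : ℤ) ∧
                gaugeAct u' (chart (ContinuousLinearMap.id ℝ (Matrix n n ℂ)) (L * tower L N j) Us (Φ' : TDir 4 n (L * tower L N j))) = vary Us X' 1 ∧
                energyNormW L (j + 1) Us X' (periodBox (d := 4) (N * L ^ (j + 1))) ^ 2 ≤ C * ‖skewPR N (relLog N V₀ V)‖ := by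
  have hL1 : 1 ≤ L := by omega
  obtain ⟨ε₁, hε₁, H⟩ := thresholds (n := n) hL
  obtain ⟨ε₂, hε₂, H2⟩ := minimisers_upperHemicontinuous (n := n) hL
  obtain ⟨ε₃, hε₃, H3⟩ := minimal_orbit_unique_generic (n := n) hL
  obtain ⟨ε₄, hε₄, H4⟩ := minAct_upper_lipschitz (n := n) hL
  obtain ⟨c₀, hc₀, ε₅, hε₅, H5⟩ := action_quadratic_growth_any_datum (n := n) hL
  refine ⟨min ε₁ (min ε₂ (min ε₃ (min ε₄ ε₅))), lt_min hε₁ (lt_min hε₂ (lt_min hε₃ (lt_min hε₄ hε₅))), fun ε hε hεle N _ hN => ?_⟩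
  obtain ⟨-, -, hls, H1⟩ := H ε hε (hεle.trans (min_le_left _ _))
  obtain ⟨δ₁, hδ₁, hint₁⟩ := H1 N hN
  obtain ⟨δ₂, hδ₂, husc⟩ := H2 ε hε (hεle.trans ((min_le_right _ _).trans (min_le_left _ _))) N hN
  obtain ⟨δ₃, hδ₃, huniq⟩ := H3 ε hε (hεle.trans ((min_le_right _ _).trans ((min_le_right _ _).trans (min_le_left _ _)))) N hN
  obtain ⟨δ₄, hδ₄, hup⟩ := H4 ε hε (hεle.trans ((min_le_right _ _).trans ((min_le_right _ _).trans ((min_le_right _ _).trans (min_le_left _ _))))) N hN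
  have hquad := H5 ε hε (hεle.trans ((min_le_right _ _).trans ((min_le_right _ _).trans ((min_le_right _ _).trans (min_le_right _ _))))) N hN
  refine ⟨min δ₁ (min δ₂ (min δ₃ δ₄)), lt_min hδ₁ (lt_min hδ₂ (lt_min hδ₃ hδ₄)), fun V₀ hV₀ j => ?_⟩
  obtain ⟨hV₀u, hV₀P, hV₀δ⟩ := hV₀
  have hV₀1 : V₀ ∈ {V : Site 4 → Fin 4 → (Matrix n n ℂ)ˣ | IsUnitaryCfg V ∧ IsPeriodicCfg V (N : ℤ) ∧ SmallField V δ₁} :=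
    ⟨hV₀u, hV₀P, MinimalActionRate.SmallField.mono hV₀δ (min_le_left _ _)⟩
  have hV₀2 : V₀ ∈ {V : Site 4 → Fin 4 → (Matrix n n ℂ)ˣ | IsUnitaryCfg V ∧ IsPeriodicCfg V (N : ℤ) ∧ SmallField V δ₂} :=
    ⟨hV₀u, hV₀P, MinimalActionRate.SmallField.mono hV₀δ ((min_le_right _ _).trans (min_le_left _ _))⟩
  have hV₀3 : V₀ ∈ {V : Site 4 → Fin 4 → (Matrix n n ℂ)ˣ | IsUnitaryCfg V ∧ IsPeriodicCfg V (N : ℤ) ∧ SmallField V δ₃} :=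
    ⟨hV₀u, hV₀P, MinimalActionRate.SmallField.mono hV₀δ ((min_le_right _ _).trans ((min_le_right _ _).trans (min_le_left _ _)))⟩
  have hV₀4 : V₀ ∈ {V : Site 4 → Fin 4 → (Matrix n n ℂ)ˣ | IsUnitaryCfg V ∧ IsPeriodicCfg V (N : ℤ) ∧ SmallField V δ₄} :=
    ⟨hV₀u, hV₀P, MinimalActionRate.SmallField.mono hV₀δ ((min_le_right _ _).trans ((min_le_right _ _).trans (min_le_right _ _)))⟩
  -- the interior minimiser `U♯` over `V₀` (tangent-critical), the period `M`
  obtain ⟨Us, hUs, a, ha0, haε, hUsa⟩ := hint₁ V₀ hV₀1 (j + 1)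
  have hcritUs := tanCritical_of_isMinimiser hL1 hN hUs ha0 haε hUsa (hls j)
  -- the upper Lipschitz event and the quadratic growth at the centre `U♯`
  obtain ⟨Cup, hCup, hupev⟩ := hup V₀ hV₀4 j
  have hq := hquad V₀ j Us hUs.mem hcritUs
  set M : ℕ := L * tower L N j with hMdef
  have hper : N * L ^ (j + 1) = M := by rw [hMdef]; exact period_succ_eq L N j
  haveI : NeZero M := ⟨by rw [← hper]; exact Nat.mul_ne_zero (NeZero.ne N) (pow_ne_zero _ (by omega))⟩
  have hUsU : IsUnitaryCfg Us := hUs.mem.1.1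
  have hUsP : IsPeriodicCfg Us (M : ℤ) := by have h := hUs.mem.1.2.1; rwa [hper] at h
  have hUsavg : cavgIter L (j + 1) Us = V₀ := by rw [cavgIter_eq_avgIter]; exact hUs.mem.2
  -- the quantitative fibre at a moving base point of the chart at `U♯`
  obtain ⟨κ, C, Cg, ρ₀, hκ, hC, hCg, hρ₀, hF⟩ :=
    chart_fibre_quantitative (d := 4) (n := n) hL1 hε.le (hls j) hUs.mem haε hUsa (perWin 4 (N * L ^ (j + 1)))
  -- the level weight and the final constant
  set w : ℝ := ((stepWt 4 L)⁻¹) ^ (j + 1) with hw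
  have hw0 : 0 < w := pow_pos (inv_pos.mpr (stepWt_pos (d := 4) L hL1)) _
  refine ⟨Us, hUs, max (1 / κ) ((Cup / w + C / κ) / c₀), le_max_of_le_left (by positivity), ?_⟩
  -- the neighbourhood `𝒩` of `U♯` (bondwise on the period box) and the localising open set `𝒰`
  set δ : ℝ := min (1 / 8) (ρ₀ / 4) with hδ
  have hδ0 : 0 < δ := lt_min (by norm_num) (by positivity)
  have hδ8 : δ ≤ 1 / 8 := min_le_left _ _
  have hδρ : δ ≤ ρ₀ / 4 := min_le_right _ _
  set 𝒩 : Set (Site 4 → Fin 4 → (Matrix n n ℂ)ˣ) := {X | ∀ (r : Fin 4 → Fin M) (κ' : Fin 4),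
    ‖(((Us (boxVec M r) κ')⁻¹ : (Matrix n n ℂ)ˣ) : Matrix n n ℂ) * (X (boxVec M r) κ' : Matrix n n ℂ) - 1‖ < δ} with h𝒩
  have h𝒩o : IsOpen 𝒩 := by
    have e : 𝒩 = ⋂ r : Fin 4 → Fin M, ⋂ κ' : Fin 4, {X : Site 4 → Fin 4 → (Matrix n n ℂ)ˣ |
        ‖(((Us (boxVec M r) κ')⁻¹ : (Matrix n n ℂ)ˣ) : Matrix n n ℂ) * (X (boxVec M r) κ' : Matrix n n ℂ) - 1‖ < δ} := by
      ext X; simp only [h𝒩, mem_setOf_eq, mem_iInter]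
    rw [e]
    refine isOpen_iInter_of_finite fun r => isOpen_iInter_of_finite fun κ' => ?_
    exact isOpen_lt (((continuous_relVal Us (boxVec M r) κ').sub continuous_const).norm) continuous_const
  set 𝒰 : Set (Site 4 → Fin 4 → (Matrix n n ℂ)ˣ) := {U | ∃ u : Site 4 → (Matrix n n ℂ)ˣ, IsUnitarySite u ∧
    IsPeriodicSite u ((N * L ^ (j + 1) : ℕ) : ℤ) ∧ gaugeAct (fun z : Site 4 => u (((L : ℤ) ^ (j + 1)) • z)) V₀ = V₀ ∧ gaugeAct u U ∈ 𝒩} with h𝒰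
  have h𝒰o : IsOpen 𝒰 := by
    rw [isOpen_iff_mem_nhds]
    rintro U ⟨u, hu, huP, hfix, hU𝒩⟩
    exact mem_of_superset ((h𝒩o.preimage (continuous_gaugeAct u)).mem_nhds hU𝒩) fun U' hU' => ⟨u, hu, huP, hfix, hU'⟩
  -- `𝒰` contains every minimiser over `V₀`
  have hUs𝒩 : Us ∈ 𝒩 := by
    intro r κ'
    rw [Units.inv_mul, sub_self, norm_zero]; exact hδ0
  obtain ⟨Us', -, horbit⟩ := huniq V₀ hV₀3 (j + 1)
  obtain ⟨us, hus, husP, hgs⟩ := horbit Us hUs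
  have h𝒰min : ∀ U' : Site 4 → Fin 4 → (Matrix n n ℂ)ˣ, IsMinimiser 4 (sfClass 4 L N ε) L N (j + 1) V₀ U' → U' ∈ 𝒰 := by
    intro U' hU'
    obtain ⟨u', hu', hu'P, hg'⟩ := horbit U' hU'
    -- `U′^{(u♯)⁻¹·u′} = U♯`
    set u : Site 4 → (Matrix n n ℂ)ˣ := fun z => (us z)⁻¹ * u' z with hudef
    have hu : IsUnitarySite u := fun z => (unitaryUnits (Matrix n n ℂ)).mul_mem ((unitaryUnits (Matrix n n ℂ)).inv_mem (hus z)) (hu' z)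
    have huP : IsPeriodicSite u ((N * L ^ (j + 1) : ℕ) : ℤ) := fun x i => by simp only [hudef, husP x i, hu'P x i]
    have hgU : gaugeAct u U' = Us := by
      have hmul : gaugeAct u U' = gaugeAct (fun z => (us z)⁻¹) (gaugeAct u' U') := by
        funext x μ; simp only [hudef, gaugeAct]; group
      rw [hmul, hg', ← hgs, gaugeAct_inv_gaugeAct]
    -- the corner values of `u` fix `V₀`: both `U′^{u}` and `U′` have average `V₀`
    have hfix : gaugeAct (fun z : Site 4 => u (((L : ℤ) ^ (j + 1)) • z)) V₀ = V₀ := by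
      have h := avgIter_gaugeAct_sfClass hL1 hε.le j (hls j) hU'.mem.1 hu
      rw [hgU, hUs.mem.2, hU'.mem.2] at h
      exact h.symm
    exact ⟨u, hu, huP, hfix, by rw [hgU]; exact hUs𝒩⟩
  -- Berge: the minimisers over nearby data lie in `𝒰`; the nearby data are bondwise near `V₀` with small coordinate
  have hU𝒰 := husc V₀ hV₀2 (j + 1) 𝒰 h𝒰o h𝒰min
  have hnear := eventually_near_base (d := 4) (n := n) N V₀
  have hcoord : ∀ᶠ V in 𝓝 V₀, ‖skewPR N (relLog N V₀ V)‖ < κ * ρ₀ := by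
    have h := tendsto_skewPR_relLog (d := 4) (n := n) N V₀
    have hb : Metric.ball (0 : ↥(skewSub 4 n N)) (κ * ρ₀) ∈ 𝓝 (0 : ↥(skewSub 4 n N)) := Metric.ball_mem_nhds _ (by positivity)
    have h2 : ∀ᶠ V in 𝓝 V₀, skewPR N (relLog N V₀ V) ∈ Metric.ball (0 : ↥(skewSub 4 n N)) (κ * ρ₀) := h hb
    exact h2.mono fun V hV => by simpa [dist_zero_right] using hV
  filter_upwards [hU𝒰, hnear, hcoord, hupev] with V hV𝒰 hVnear hVcoord hVup hVu hVP U hU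
  obtain ⟨-, hupper⟩ := hVup hVu hVP
  obtain ⟨u, hu, huP, hfix, hX𝒩⟩ := hV𝒰 hVu hVP U hU
  -- `X := U^{u}`, a minimiser over `V′ := ū·V` with the same minimal action
  set ub : Site 4 → (Matrix n n ℂ)ˣ := fun z : Site 4 => u (((L : ℤ) ^ (j + 1)) • z) with hub
  have hXmin : IsMinimiser 4 (sfClass 4 L N ε) L N (j + 1) (gaugeAct ub V) (gaugeAct u U) := isMinimiser_gaugeAct hL1 hε.le j (hls j) hU hu huP
  have hmV : minAct 4 (sfClass 4 L N ε) L N (j + 1) (gaugeAct ub V) = minAct 4 (sfClass 4 L N ε) L N (j + 1) V := by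
    rw [hXmin.minAct_eq, hU.minAct_eq, levelAction_gaugeAct]
  have hXu : IsUnitaryCfg (gaugeAct u U) := hXmin.mem.1.1
  have hXP : IsPeriodicCfg (gaugeAct u U) (M : ℤ) := by have h := hXmin.mem.1.2.1; rwa [hper] at h
  have hXavg : cavgIter L (j + 1) (gaugeAct u U) = gaugeAct ub V := by rw [cavgIter_eq_avgIter]; exact hXmin.mem.2
  -- decoding: `X = chart_{U♯}(Φ_X)` with `‖Φ_X‖ ≤ 2δ ≤ ρ₀`
  have hXnear : ∀ (r : Fin 4 → Fin M) (κ' : Fin 4),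
      ‖(((Us (boxVec M r) κ')⁻¹ : (Matrix n n ℂ)ˣ) : Matrix n n ℂ) * ((gaugeAct u U (boxVec M r) κ' : (Matrix n n ℂ)ˣ) : Matrix n n ℂ) - 1‖ ≤ δ := fun r κ' => (hX𝒩 r κ').le
  set ΦX : ↥(skewSub 4 n M) := skewPR M (relLog M Us (gaugeAct u U)) with hΦX
  have hdec : chart (ContinuousLinearMap.id ℝ (Matrix n n ℂ)) M Us (ΦX : TDir 4 n M) = gaugeAct u U :=
    chart_skewPR_relLog_eq hUsU hXu hUsP hXP fun r κ' => (hXnear r κ').trans (by linarith)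
  have hΦXn : ‖ΦX‖ ≤ 2 * δ := norm_skewPR_relLog_le hδ0.le (by linarith) hXnear
  have hΦXρ : ‖ΦX‖ ≤ ρ₀ := by linarith
  -- `g(Φ_X) = y(V′)` and `‖y(V′)‖ = ‖y(V)‖` (stabiliser invariance)
  have hg : levelQ L N j Us (chart (ContinuousLinearMap.id ℝ (Matrix n n ℂ)) M Us (ΦX : TDir 4 n M)) = skewPR N (relLog N V₀ (gaugeAct ub V)) := by
    show skewPR N (relLog N (cavgIter L (j + 1) Us) (cavgIter L (j + 1) (chart (ContinuousLinearMap.id ℝ (Matrix n n ℂ)) M Us (ΦX : TDir 4 n M))))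
      = skewPR N (relLog N V₀ (gaugeAct ub V))
    rw [hdec, hUsavg, hXavg]
  have hyeq : ‖skewPR N (relLog N V₀ (gaugeAct ub V))‖ = ‖skewPR N (relLog N V₀ V)‖ :=
    norm_skewPR_relLog_gaugeAct_stab (fun z => isUnitarySite_corner hu _ z) hfix hVnear
  -- the quantitative fibre at the base point `Φ_X`, target `V₀`
  obtain ⟨-, hfib⟩ := hF ΦX hΦXρ
  have hy0 : skewPR N (relLog N V₀ V₀) = 0 := by rw [relLog_self, map_zero]
  have hV₀near : ∀ (r : Fin 4 → Fin N) (κ' : Fin 4),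
      ‖(((V₀ (boxVec N r) κ')⁻¹ : (Matrix n n ℂ)ˣ) : Matrix n n ℂ) * (V₀ (boxVec N r) κ' : Matrix n n ℂ) - 1‖ ≤ 1 / 4 := by
    intro r κ'; rw [Units.inv_mul, sub_self, norm_zero]; norm_num
  have hdist : ‖skewPR N (relLog N V₀ V₀) - levelQ L N j Us (chart (ContinuousLinearMap.id ℝ (Matrix n n ℂ)) M Us (ΦX : TDir 4 n M))‖ = ‖skewPR N (relLog N V₀ V)‖ := by
    rw [hy0, hg, zero_sub, norm_neg, hyeq]
  obtain ⟨Φ', hΦ'd, hΦ'adm, hΦ'act⟩ := hfib V₀ hV₀u hV₀P hV₀near (by rw [hdist]; exact hVcoord.le)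
  rw [hdist] at hΦ'd
  -- the quadratic growth at `U♯` applied to the competitor `chart Φ′` over `V₀`
  obtain ⟨u', X', hu', hu'P, hX's, hX'P, hgauge', hE⟩ := hq _ hΦ'adm
  have h2 : fineAction (chart (ContinuousLinearMap.id ℝ (Matrix n n ℂ)) M Us (Φ' : TDir 4 n M)) (perWin 4 (N * L ^ (j + 1)))
      ≤ fineAction (gaugeAct u U) (perWin 4 (N * L ^ (j + 1))) + C * (‖skewPR N (relLog N V₀ V)‖ / κ) := by
    have h := (abs_sub_le_iff.mp hΦ'act).1
    rw [hdec] at h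
    have h3 : C * ‖Φ' - ΦX‖ ≤ C * (‖skewPR N (relLog N V₀ V)‖ / κ) := mul_le_mul_of_nonneg_left hΦ'd hC
    linarith
  have h6 : levelAction 4 L N (j + 1) (gaugeAct u U) = minAct 4 (sfClass 4 L N ε) L N (j + 1) V := by
    rw [← hmV, hXmin.minAct_eq]
  have h7 : minAct 4 (sfClass 4 L N ε) L N (j + 1) V₀ = levelAction 4 L N (j + 1) Us := hUs.minAct_eq
  -- `w·A(X) ≤ w·A(U♯) + C_up‖y‖`
  have h8 : w * fineAction (gaugeAct u U) (perWin 4 (N * L ^ (j + 1))) ≤ w * fineAction Us (perWin 4 (N * L ^ (j + 1))) + Cup * ‖skewPR N (relLog N V₀ V)‖ := by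
    have e1 : levelAction 4 L N (j + 1) (gaugeAct u U) = w * fineAction (gaugeAct u U) (perWin 4 (N * L ^ (j + 1))) := by rw [hw]; rfl
    have e2 : levelAction 4 L N (j + 1) Us = w * fineAction Us (perWin 4 (N * L ^ (j + 1))) := by rw [hw]; rfl
    rw [← e1, ← e2, h6, ← h7]
    exact hupper
  set yn : ℝ := ‖skewPR N (relLog N V₀ V)‖ with hyn
  have hy0 : 0 ≤ yn := norm_nonneg _
  -- `A(chart Φ′) − A(U♯) ≤ (C_up∕w + C∕κ)·‖y‖`, hence the energy bound
  have h9 : fineAction (chart (ContinuousLinearMap.id ℝ (Matrix n n ℂ)) M Us (Φ' : TDir 4 n M)) (perWin 4 (N * L ^ (j + 1)))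
      - fineAction Us (perWin 4 (N * L ^ (j + 1))) ≤ (Cup / w + C / κ) * yn := by
    have h10 : fineAction (gaugeAct u U) (perWin 4 (N * L ^ (j + 1))) ≤ fineAction Us (perWin 4 (N * L ^ (j + 1))) + Cup / w * yn := by
      have hw' : w ≠ 0 := hw0.ne'
      have e1 : fineAction (gaugeAct u U) (perWin 4 (N * L ^ (j + 1))) = (w * fineAction (gaugeAct u U) (perWin 4 (N * L ^ (j + 1)))) / w := by
        field_simp
      have e2 : fineAction Us (perWin 4 (N * L ^ (j + 1))) + Cup / w * yn = (w * fineAction Us (perWin 4 (N * L ^ (j + 1))) + Cup * yn) / w := by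
        field_simp
      rw [e1, e2]
      exact div_le_div_of_nonneg_right h8 hw0.le
    have e5 : (Cup / w + C / κ) * yn = Cup / w * yn + C * (yn / κ) := by ring
    rw [e5]; linarith
  have hE' : energyNormW L (j + 1) Us X' (periodBox (d := 4) (N * L ^ (j + 1))) ^ 2 ≤ (Cup / w + C / κ) / c₀ * yn := by
    rw [div_mul_eq_mul_div, le_div_iff₀ hc₀]
    calc energyNormW L (j + 1) Us X' (periodBox (d := 4) (N * L ^ (j + 1))) ^ 2 * c₀
        = c₀ * energyNormW L (j + 1) Us X' (periodBox (d := 4) (N * L ^ (j + 1))) ^ 2 := by ring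
      _ ≤ _ := hE
      _ ≤ (Cup / w + C / κ) * yn := h9
  -- assemble
  refine ⟨u, ΦX, Φ', u', X', hu, huP, hdec.symm, hΦ'adm, ?_, hu', hu'P, hX's, hX'P, hgauge', ?_⟩
  · have h1 : ‖ΦX - Φ'‖ ≤ yn / κ := by rw [norm_sub_rev]; exact hΦ'd
    have h2' : yn / κ = 1 / κ * yn := by ring
    rw [h2'] at h1
    exact h1.trans (mul_le_mul_of_nonneg_right (le_max_left _ _) hy0)
  · exact hE'.trans (mul_le_mul_of_nonneg_right (le_max_right _ _) hy0)

end

end Summit.QuantumFields.BalabanUV.T4Continuum.NE7MinimiserHoelderHalf
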